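import Summits.BirchSwinnertonDyer.BirchSwinnertonDyer.Theorems.AdditiveBranchIMCCharacterLFunctionPresentation
import Summits.BirchSwinnertonDyer.BirchSwinnertonDyer.Theorems.AdditiveBranchIMCGreenbergVatsalResidualBranchTransport
import Summits.BirchSwinnertonDyer.BirchSwinnertonDyer.Theorems.AdditiveBranchIMCGreenbergVatsalResidualBranchCharacters
import Summits.BirchSwinnertonDyer.BirchSwinnertonDyer.Theorems.AdditiveBranchIMCGreenbergVatsalResidualBranchGoodReduction
import Summits.BirchSwinnertonDyer.Rank1Residual.Additive.X3BranchResidualCountOfCharacters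
import Literature.NumberTheory.EllipticCurves.GreenbergVatsal2000.EisensteinCongruenceTwisted
import Literature.NumberTheory.EllipticCurves.GreenbergVatsal2000.EisensteinCongruenceResidualBranch
import Literature.NumberTheory.EllipticCurves.GreenbergVatsal2000.MultiplicativeReduction
import HarnessLib

/-!
# The READING `thm312_branch_…` (GV Thm. (3.12) on the `ω^{(p−1)/2}`-branch, residual groups of the
# additive twist) on its EVEN-SIGN half `p ≡ 1 (mod 4)` is a KERNEL CONSEQUENCE of three typed,
# verbatim-er Greenberg–Vatsal statements: Thm. (3.11) at `χ = (·/p)` + the two character sentences of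
# pp. 41–42 at a twist (route K1 `AdditiveBranchIMC`, crux ReadingFacts stmt-…-19361, child **19297**
# `GreenbergVatsalResidualBranch` — supports only; seat `bsd-inputs-abimc-rf-p1`)

HONEST FRAMING (cell `bsd-addord`, `run/shared/lean/pub/bsd-addord/README.md` §4): the programme's
target of record is the full Birch–Swinnerton-Dyer formula for every `E/ℚ` of analytic rank `≤ 1`;
this file books NOTHING and proves no named fact: it is KERNEL GLUE between named facts of the tree.
THEOREMS ONLY (no `def`, no `sorry`). BSD is not proved by any of this.

## What

Item 19297 is the bare named fact hGV =
`GreenbergVatsal2000.thm312_branch_unitContent_and_lambda_eq_residual_goodOrd` (a READING of GV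
Thm. (3.12) + (26)–(28) + pp. 41–43 + §2 p. 29 at `χ = ω^{(p−1)/2}`, audit sheet
`HOME/audit/D-AUDIT-19361-stub_gvBranch.md`: PASS, composite of printed statements). The tree ALSO
holds, as separate named facts typed closer to print,
* T311χ = `thm311_quadraticTwist_hasUnitContent_iff_and_order_eq_of_lineRamifiedEven` (p396680): GV
  Thm. (3.11) "Let `χ` be any even character" at `χ = (·/p)`, `p ≡ 1 (mod 4)`, with (28): the congruence
  `L_{Σ₀}(E/ℚ,χ,T) ≡ u·L_{Σ₀}(C,χ,T)L_{Σ₀}(D,χ,T)` read through unit content / `ord_T`, the character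
  `L`-functions being ANY solutions `g_C`, `g_D` of the tree's interpolation predicates;
* C = `characterLFunctionC_hasUnitContent_and_order_eq_card_of_ne_one`,
  D = `characterLFunctionD_hasUnitContent_and_order_eq_card_of_ne_teichmuller` (GV pp. 41–42 + p. 29:
  Ferrero–Washington, Mazur–Wiles, Props. (2.6)/(2.8), at a twist).
**`thm312_branch_of_thm311Twisted_of_characterFacts_of_mod_four_eq_one`**: T311χ ∧ C ∧ D ⟹ hGV's
conclusion for EVERY instance of hGV's hypotheses with `p ≡ 1 (mod 4)` (same binders, same
conclusion). So on the even-sign rows the reading hGV carries no content beyond T311χ ∧ C ∧ D +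
kernel glue.

## How (the glue, all kernel-checked; tools in the three sibling files)

`W = C • V^{(p)}`; along the sign-equivariant `e : W[p] ≃ V[p]` (`exists_signEquiv_of_twist`) the even
non-degenerate line `Φ₀ ≤ W[p]` whose `χ`-twist is ramified goes to an even RAMIFIED rational line
`Φ₁ ≤ V[p]` (sign = `σ√p = √p` = `σ ∈ Gal(ℚ̄/K)`, `…Transport.mem_galRange_iff_smul_geomSqrt_eq`);
Kronecker–Weber gives its primitive characters `φ` mod `m`, `ψ` mod `d` (X2 `exists_character_sub/quot`);
T311χ at `(V, W, Φ₁, φ, ψ)` and `b₀ = u⁻¹b` yields `HUC(b∏𝒫) ↔ HUC(g_Cg_D)` and `ord = ord` for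
solutions `g_C`, `g_D` at the PRODUCT presentations `(·/p)·φ`, `ψ·(·/p)`; the characters of `Φ₀`,
`W[p]/Φ₀` are these products (sign = Legendre symbol of `χ_p`, quadratic Gauss sum,
`…Transport.ite_smul_geomSqrt_pStar_eq_quadraticChar`), so C and D apply to their PRIMITIVE characters
on `W`'s residual modules and give `HUC`, `p^{ord g_C} = #H¹(ℚ_Σ/ℚ_∞, Φ₀)`, `p^{ord g_D} = #U`; the
interpolation predicates do not see the presentation (`…CharacterLFunctionPresentation`), and
`ord_T` is additive in the domain `𝔽_p⟦T⟧`; T311χ's good-reduction hypothesis for `V` off `Σ₀ ∪ {p}`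
is hGV's for `W` transported along the twist, unramified off `p` (`…GoodReduction`).

## What is NOT here

The ODD-sign half `p ≡ 3 (mod 4)` (it needs GV Thm. (3.12) at the odd quadratic character typed in
the `g_C·g_D` shape — not in the tree); any `_holds` (T311χ, C, D stay named facts; the reducibility
hypothesis of hGV is not even used: it is implied by the existence of the rational line).

References: [GreenbergVatsal2000] §2 pp. 28–29, §3 Thm. (3.11), Thm. (3.12), (24), (26)–(28) pp. 39–45;
[SilvermanAEC2009] X.5 Cor. 5.4; [IrelandRosen1990] Ch. 6 Prop. 6.3.2; [LangCyclotomic1990] Ch. 2 §2;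
[Washington1997] Ch. 3, §7.
-/

set_option autoImplicit false
set_option linter.dupNamespace false

noncomputable section

open scoped Classical MatrixGroups ModularForm

namespace Summit.BirchSwinnertonDyer.BirchSwinnertonDyer.Theorems.AdditiveBranchIMCGreenbergVatsalResidualBranchOfPrint

open NumberField IsDedekindDomain Field WeierstrassCurve CongruenceSubgroup PowerSeries
  Literature.NumberTheory.EllipticCurves Literature.NumberTheory.GaloisRepresentations
  Literature.NumberTheory.EllipticCurves.ModularForms
  Literature.NumberTheory.EllipticCurves.Rank1Residual
  Literature.NumberTheory.EllipticCurves.GreenbergVatsal2000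
  Summit.BirchSwinnertonDyer.Rank1Residual.Additive
  Summit.BirchSwinnertonDyer.Rank1Residual.X2.ResidualDevissageLine
  Summit.BirchSwinnertonDyer.Rank1Residual.X2.ResidualLineCharacters
  Summit.BirchSwinnertonDyer.BirchSwinnertonDyer.Theorems.AdditiveBranchIMCCharacterLFunctionPresentation
  Summit.BirchSwinnertonDyer.BirchSwinnertonDyer.Theorems.AdditiveBranchIMCGreenbergVatsalResidualBranchTransport
  Summit.BirchSwinnertonDyer.BirchSwinnertonDyer.Theorems.AdditiveBranchIMCGreenbergVatsalResidualBranchCharacters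
  Summit.BirchSwinnertonDyer.BirchSwinnertonDyer.Theorems.AdditiveBranchIMCGreenbergVatsalResidualBranchGoodReduction

/-! ### §0 Small tools -/

section Tools

variable {p : ℕ} [hp : Fact p.Prime]

/-- `θ² = p` has no rational solution (`p` prime). [folklore] -/
theorem not_mem_range_algebraMap_of_sq_eq_prime {K : Type} [Field K] [CharZero K] {θ : K}
    (hθ : θ ^ 2 = algebraMap ℚ K p) : θ ∉ Set.range (algebraMap ℚ K) := by
  rintro ⟨q, rfl⟩
  rw [← map_pow] at hθ
  have hq : q ^ 2 = p := (algebraMap ℚ K).injective hθ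
  have hsq : IsSquare (p : ℚ) := ⟨q, by rw [← sq, hq]⟩
  exact hp.out.prime.not_isSquare (Rat.isSquare_natCast_iff.mp hsq)

/-- `p ∉ v` for `v ∈ Σ₀` means `p ∤ ℓ_v`. [folklore] -/
theorem not_dvd_natGenerator_of_not_mem {S₀ : Finset (HeightOneSpectrum (𝓞 ℚ))}
    (hS₀ : ∀ v ∈ S₀, ((p : ℕ) : 𝓞 ℚ) ∉ v.asIdeal) (v : HeightOneSpectrum (𝓞 ℚ)) (hv : v ∈ S₀) :
    ¬ p ∣ Rat.HeightOneSpectrum.natGenerator v := by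
  intro h
  have heq : p = Rat.HeightOneSpectrum.natGenerator v :=
    (Nat.prime_dvd_prime_iff_eq hp.out (Rat.HeightOneSpectrum.prime_natGenerator v)).mp h
  apply hS₀ v hv
  rw [heq]
  exact Rat.HeightOneSpectrum.natCast_natGenerator_mem v

end Tools

/-! ### §1 The even-sign half of the reading from T311χ ∧ C ∧ D -/

/-- **GV Thm. (3.12) on the `ω^{(p−1)/2}`-branch (the reading hGV, item 19297) for `p ≡ 1 (mod 4)`,
FROM the typed Thm. (3.11) at `χ = (·/p)` and the two twisted character facts.** For every instance
of the hypotheses of `thm312_branch_unitContent_and_lambda_eq_residual_goodOrd` with `p ≡ 1 (mod 4)`: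
`b·∏_{ℓ∈Σ₀}𝒫_ℓ(W)` has unit content and
`p^{ord_T(b∏𝒫 mod p)} = #H¹(ℚ_Σ/ℚ_∞, Φ₀)·#U(W[p]/Φ₀)`. Proof = the module docstring's glue (twist
transport of the line datum, Kronecker–Weber characters, Legendre sign via the Gauss sum, product vs
primitive presentations, `ord_T` additive over `𝔽_p⟦T⟧`).
[cite: GreenbergVatsal2000, §3 Thm. (3.11), Thm. (3.12) p. 45, (26)–(28) pp. 41–43; §2 pp. 28–29] -/
theorem thm312_branch_of_thm311Twisted_of_characterFacts_of_mod_four_eq_one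
    (h311 : thm311_quadraticTwist_hasUnitContent_iff_and_order_eq_of_lineRamifiedEven)
    (hCfact : characterLFunctionC_hasUnitContent_and_order_eq_card_of_ne_one)
    (hDfact : characterLFunctionD_hasUnitContent_and_order_eq_card_of_ne_teichmuller)
    (V : WeierstrassCurve ℚ) [V.IsGloballyMinimal] [V.IsElliptic]
    (W : WeierstrassCurve ℚ) [W.IsGloballyMinimal] [W.IsElliptic] (p : ℕ) [hp : Fact p.Prime]
    (K : Type) [Field K] [NumberField K] [(galRange (K := ℚ) K).Normal]
    (κ : ZpExtension ℚ p) {N : ℕ} [NeZero N] (f : CuspForm (Gamma0 N) 2)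
    (S₀ : Finset (HeightOneSpectrum (𝓞 ℚ)))
    (Φ₀ : AddSubgroup (W.geomTorsion (p : ℤ))) (hΦ : IsRationalLine W p Φ₀)
    (hp2 : p ≠ 2) (hp4 : p % 4 = 1) (hgood : V.HasGoodReductionAtPrime p)
    (hord : ¬ (p : ℤ) ∣ V.frobeniusTrace p) (_hred : ¬ V.HasIrreducibleModPGaloisRep p)
    (h2 : Module.finrank ℚ K = 2) (hθ : ∃ θ : K, θ ^ 2 = algebraMap ℚ K ((-1) ^ (p / 2) * p))
    (hCW : ∃ C : VariableChange ℚ, C • V.quadraticTwist ((-1) ^ (p / 2) * p : ℚ) = W)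
    (hκ : κ.IsCyclotomic) (hf : IsNewformOf V f) (heven : LineEven W p Φ₀)
    (hnt : ∃ (σ : absoluteGaloisGroup ℚ) (P : W.geomTorsion (p : ℤ)), P ∈ Φ₀ ∧ σ • P ≠ P)
    (hram : ¬ ∀ v : HeightOneSpectrum (𝓞 ℚ), ((p : ℕ) : 𝓞 ℚ) ∈ v.asIdeal →
        ∀ 𝔓 ∈ v.primesAbove, ∀ σ ∈ 𝔓.inertia (absoluteGaloisGroup ℚ), ∀ P ∈ Φ₀,
          σ • P = (if σ ∈ galRange (K := ℚ) K then P else -P))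
    (hS₀ : ∀ v ∈ S₀, ((p : ℕ) : 𝓞 ℚ) ∉ v.asIdeal)
    (hS : ∀ v : HeightOneSpectrum (𝓞 ℚ), v ∉ S₀ → ((p : ℕ) : 𝓞 ℚ) ∉ v.asIdeal →
      W.HasGoodReductionAt v)
    (ϖ : ℚ) (hϖ : if Even (p / 2) then (ϖ : ℝ) * V.realPeriodRat = plusPeriod f
        else (ϖ : ℝ) * V.imaginaryPeriodRat = minusPeriod f)
    (b : IwasawaAlgebra p) (u : ℤ_[p]ˣ)
    (hb : iwasawaToPowerSeries p b =
        PowerSeries.C ((((u : ℤ_[p]) : ℚ_[p])) * ((ϖ : ℚ) : ℚ_[p])) *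
          (if Even (p / 2) then padicLFunctionBranch f ((unitRoot V p : ℤ_[p]) : ℚ_[p]) (p / 2)
            else padicLFunctionMinusBranch f ((unitRoot V p : ℤ_[p]) : ℚ_[p]) (p / 2))) :
    HasUnitContent (b * eulerFactorProduct W p S₀) ∧
      p ^ (PowerSeries.map (PadicInt.toZMod (p := p)) (b * eulerFactorProduct W p S₀)).order.toNat =
        Nat.card (residualLineH1 W p κ S₀ Φ₀ hΦ) * Nat.card (residualQuotSelmer W p κ S₀ Φ₀ hΦ) := by
  have hpr : p.Prime := hp.out
  -- parity of `(p−1)/2` and `p* = p`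
  have heven2 : Even (p / 2) := Nat.even_iff.mpr (by omega)
  rw [if_pos heven2] at hϖ hb
  have hd : ((-1 : ℚ) ^ (p / 2) * p) = (p : ℚ) := by rw [heven2.neg_one_pow, one_mul]
  -- the twist model and the sign-equivariant `e : W[p] ≃ V[p]`
  obtain ⟨C, hC⟩ := hCW
  rw [hd] at hC
  have hC' : C⁻¹ • W = V.quadraticTwist (p : ℚ) := by rw [← hC, inv_smul_smul]
  have hSV : ∀ v : HeightOneSpectrum (𝓞 ℚ), v ∉ S₀ → ((p : ℕ) : 𝓞 ℚ) ∉ v.asIdeal →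
      V.HasGoodReductionAt v :=
    hasGoodReductionAt_of_quadraticTwist_smul_eq_of_mod_four_eq_one V W hp4 hC hS
  have hp0 : (p : ℚ) ≠ 0 := by exact_mod_cast hpr.ne_zero
  obtain ⟨e, hpos, hneg⟩ := exists_signEquiv_of_twist (W := V) (Wd := W) (p := p) hp0 C⁻¹ hC'
  set ε : absoluteGaloisGroup ℚ → Prop := fun σ ↦ σ • geomSqrt (p : ℚ) = geomSqrt (p : ℚ) with hε
  -- the transported line datum on `V`
  set Φ₁ : AddSubgroup (V.geomTorsion (p : ℤ)) := Φ₀.map e.toAddMonoidHom with hΦ₁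
  have hΦ₁r : IsRationalLine V p Φ₁ := isRationalLine_map_signEquiv e ε hpos hneg hΦ
  have heven₁ : LineEven V p Φ₁ :=
    (lineEven_map_signEquiv_iff_of_pos e ε hpos (fun c hc ↦
      smul_geomSqrt_eq_of_isComplexConjugation_of_pos (by exact_mod_cast hpr.pos) hc) Φ₀).mpr heven
  obtain ⟨θ, hθ⟩ := hθ
  rw [hd] at hθ
  have hθK : θ ∉ Set.range (algebraMap ℚ K) := not_mem_range_algebraMap_of_sq_eq_prime hθ
  have hKε : ∀ σ : absoluteGaloisGroup ℚ, σ ∈ galRange (K := ℚ) K ↔ ε σ := fun σ ↦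
    mem_galRange_iff_smul_geomSqrt_eq K h2 hθK hθ σ
  have hram₁ : ¬ LineUnramifiedAt V p Φ₁ := by
    intro hunr
    apply hram
    intro v hv 𝔓 h𝔓 σ hσ P hP
    have h1 := (lineUnramifiedAt_map_iff_forall_smul_eq_ite e ε hpos hneg Φ₀).mp hunr v hv 𝔓 h𝔓 σ hσ
      P hP
    by_cases hσK : σ ∈ galRange (K := ℚ) K
    · rw [if_pos hσK]; rwa [if_pos ((hKε σ).mp hσK)] at h1
    · rw [if_neg hσK]; rwa [if_neg (fun h ↦ hσK ((hKε σ).mpr h))] at h1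
  -- the characters of `Φ₁` and `V[p]/Φ₁` (Kronecker–Weber)
  obtain ⟨m, hm, φ, hφprim, -, hφ0⟩ := exists_character_sub hΦ₁r
  obtain ⟨d, hdne, ψ, hψprim, -, hψ0⟩ := exists_character_quot hΦ₁r
  -- the sign is the Legendre symbol of `χ_p`
  have hsgn : ∀ σ : absoluteGaloisGroup ℚ, (if ε σ then (1 : ℤ) else -1) =
      quadraticChar (ZMod p) ((modNCyclotomicCharacter ℚ p σ : (ZMod p)ˣ) : ZMod p) := by
    intro σ
    have h := ite_smul_geomSqrt_pStar_eq_quadraticChar hp2 σ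
    rwa [hd] at h
  -- the product presentations of T311χ and their primitive characters
  set χq : DirichletCharacter (ZMod p) p :=
    (quadraticChar (ZMod p)).ringHomComp (Int.castRingHom (ZMod p)) with hχq
  set φ' : DirichletCharacter (ZMod p) (p * m) :=
    DirichletCharacter.changeLevel (dvd_mul_right p m) χq *
      DirichletCharacter.changeLevel (dvd_mul_left m p) φ with hφ'
  set ψ' : DirichletCharacter (ZMod p) (d * p) :=
    DirichletCharacter.changeLevel (dvd_mul_right d p) ψ *
      DirichletCharacter.changeLevel (dvd_mul_left p d) χq with hψ'
  haveI : NeZero (p * m) := ⟨mul_ne_zero hpr.ne_zero (NeZero.ne m)⟩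
  haveI : NeZero (d * p) := ⟨mul_ne_zero (NeZero.ne d) hpr.ne_zero⟩
  haveI : NeZero φ'.conductor := ⟨φ'.conductor_ne_zero⟩
  haveI : NeZero ψ'.conductor := ⟨ψ'.conductor_ne_zero⟩
  have hχqval : ∀ σ : absoluteGaloisGroup ℚ,
      χq ((modNCyclotomicCharacter ℚ p σ : (ZMod p)ˣ) : ZMod p) =
        ((if ε σ then (1 : ℤ) else -1 : ℤ) : ZMod p) := by
    intro σ
    rw [hsgn σ, hχq, MulChar.ringHomComp_apply]
    rfl
  -- (F1) the character of `Φ₀ ≤ W[p]` is `θ_C = φ'.primitiveCharacter`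
  have hθC0 : ∀ (σ : absoluteGaloisGroup ℚ), ∀ P ∈ Φ₀,
      σ • P = (φ'.primitiveCharacter ((modNCyclotomicCharacter ℚ φ'.conductor σ :
        (ZMod φ'.conductor)ˣ) : ZMod φ'.conductor)).val • P := by
    intro σ P hP
    set n : ℕ := (φ ((modNCyclotomicCharacter ℚ m σ : (ZMod m)ˣ) : ZMod m)).val with hn
    have h1 : σ • P = (if ε σ then (n : ℤ) else -(n : ℤ)) • P :=
      smul_eq_ite_zsmul_of_forall_map e ε hpos hneg
        (fun Q hQ ↦ by rw [hφ0 σ Q hQ, ← hn, natCast_zsmul]) hP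
    rw [h1, ← natCast_zsmul]
    refine zsmul_eq_zsmul_of_intCast_eq ?_ P
    have hite : (if ε σ then (n : ℤ) else -(n : ℤ)) = (if ε σ then (1 : ℤ) else -1) * n := by
      split_ifs <;> ring
    rw [Int.cast_natCast, ZMod.natCast_zmod_val, primitiveCharacter_apply_modN,
      mul_changeLevel_apply_modN, hite, Int.cast_mul, ← hχqval σ, Int.cast_natCast, hn,
      ZMod.natCast_zmod_val]
  have hθCA : ∀ (σ : absoluteGaloisGroup ℚ) (x : (lineSub Φ₀ hΦ).Sub),
      σ • x = (φ'.primitiveCharacter ((modNCyclotomicCharacter ℚ φ'.conductor σ :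
        (ZMod φ'.conductor)ˣ) : ZMod φ'.conductor)).val • x :=
    fun σ x ↦ X3Branch.smul_sub_eq_of_forall_mem hΦ (hθC0 σ) x
  -- (F2) the character of `W[p]/Φ₀` is `θ_D = ψ'.primitiveCharacter`
  have hθD0 : ∀ (σ : absoluteGaloisGroup ℚ) (P : W.geomTorsion (p : ℤ)),
      σ • P - (ψ'.primitiveCharacter ((modNCyclotomicCharacter ℚ ψ'.conductor σ :
        (ZMod ψ'.conductor)ˣ) : ZMod ψ'.conductor)).val • P ∈ Φ₀ := by
    intro σ P
    set n : ℕ := (ψ ((modNCyclotomicCharacter ℚ d σ : (ZMod d)ˣ) : ZMod d)).val with hn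
    have h1 : σ • P - (if ε σ then (n : ℤ) else -(n : ℤ)) • P ∈ Φ₀ :=
      smul_sub_ite_zsmul_mem_of_forall_map e ε hpos hneg
        (fun Q ↦ by have h := hψ0 σ Q; rwa [← hn, ← natCast_zsmul] at h) P
    have h2 : (ψ'.primitiveCharacter ((modNCyclotomicCharacter ℚ ψ'.conductor σ :
        (ZMod ψ'.conductor)ˣ) : ZMod ψ'.conductor)).val • P =
        (if ε σ then (n : ℤ) else -(n : ℤ)) • P := by
      rw [← natCast_zsmul]
      refine zsmul_eq_zsmul_of_intCast_eq ?_ P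
      have hite : (if ε σ then (n : ℤ) else -(n : ℤ)) = (n : ℤ) * (if ε σ then (1 : ℤ) else -1) := by
        split_ifs <;> ring
      rw [Int.cast_natCast, ZMod.natCast_zmod_val, primitiveCharacter_apply_modN,
        mul_changeLevel_apply_modN, hite, Int.cast_mul, ← hχqval σ, Int.cast_natCast, hn,
        ZMod.natCast_zmod_val]
    rwa [h2]
  have hθDQ : ∀ (σ : absoluteGaloisGroup ℚ) (y : (lineSub Φ₀ hΦ).Quot),
      σ • y = (ψ'.primitiveCharacter ((modNCyclotomicCharacter ℚ ψ'.conductor σ :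
        (ZMod ψ'.conductor)ˣ) : ZMod ψ'.conductor)).val • y :=
    fun σ y ↦ smul_quot_eq_of_forall_mem hΦ (hθD0 σ) y
  -- primitivity, parity, non-triviality, conductor support
  have hθCprim := DirichletCharacter.primitiveCharacter_isPrimitive φ'
  have hθDprim := DirichletCharacter.primitiveCharacter_isPrimitive ψ'
  have hθCeven : φ'.primitiveCharacter.Even := even_of_lineEven hΦ heven hθCA
  have hθDodd : ψ'.primitiveCharacter.Odd := odd_of_lineEven hΦ hp2 heven hθDQ
  have hθC1 : φ'.primitiveCharacter ≠ 1 := X3Branch.character_sub_ne_one_of_exists_smul_ne hnt hθC0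
  have hθDω := X3Branch.exists_coprime_apply_ne_of_exists_smul_ne hΦ hnt hθC0 hθD0
  have hSm : ∀ ℓ : ℕ, ℓ.Prime → ℓ ∣ φ'.conductor → ℓ ≠ p →
      ∃ v ∈ S₀, ((ℓ : ℕ) : 𝓞 ℚ) ∈ v.asIdeal :=
    fun ℓ hℓ hℓm hℓp ↦ exists_mem_of_dvd_level_sub hΦ hS hθCprim hθCA hℓ hℓm hℓp
  have hSd : ∀ ℓ : ℕ, ℓ.Prime → ℓ ∣ ψ'.conductor → ℓ ≠ p →
      ∃ v ∈ S₀, ((ℓ : ℕ) : 𝓞 ℚ) ∈ v.asIdeal :=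
    fun ℓ hℓ hℓd hℓp ↦ X3Branch.exists_mem_of_dvd_level_quot_of_ne hΦ hS hθDprim hθDQ hℓ hℓd hℓp
  -- the character `p`-adic `L`-functions (Kubota–Leopoldt–Iwasawa, proved) and the facts C, D on `W`
  obtain ⟨gC, hgC⟩ := exists_isCharacterLFunctionC_of_ne_one p φ'.primitiveCharacter S₀ hp2 hθC1
  obtain ⟨gD, hgD⟩ := exists_isCharacterLFunctionD_of_exists_ne p ψ'.primitiveCharacter S₀ hp2 hθDω hS₀
  obtain ⟨hCunit, hCcard⟩ := hCfact p κ φ'.conductor φ'.primitiveCharacter S₀ (lineSub Φ₀ hΦ).Sub hp2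
    hθCprim hθCeven hθC1 hκ hS₀ hSm (natCard_sub_eq hΦ) hθCA gC hgC
  obtain ⟨hDunit, hDcard⟩ := hDfact p κ ψ'.conductor ψ'.primitiveCharacter S₀ (lineSub Φ₀ hΦ).Quot
    hp2 hθDprim hθDodd hθDω hκ hS₀ hSd (natCard_quot_eq hΦ) hθDQ gD hgD
  -- the SAME `gC`, `gD` solve the interpolation problems at the product presentations
  have hS₀nat : ∀ v ∈ S₀, ¬ p ∣ Rat.HeightOneSpectrum.natGenerator v :=
    not_dvd_natGenerator_of_not_mem hS₀
  have hcopP : ∀ a : ℕ, ¬ p ∣ a → a.Coprime p := fun a ha ↦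
    (Nat.coprime_comm.mp ((Nat.Prime.coprime_iff_not_dvd hpr).mpr ha))
  have hagreeC : ∀ a : ℕ, ¬ p ∣ a → (¬ ∃ v ∈ S₀, Rat.HeightOneSpectrum.natGenerator v ∣ a) →
      φ' (a : ZMod (p * m)) = φ'.primitiveCharacter (a : ZMod φ'.conductor) := by
    intro a hpa hSa
    refine apply_natCast_eq_primitiveCharacter_of_coprime φ' (Nat.Coprime.mul_right (hcopP a hpa) ?_)
    by_contra hnc
    obtain ⟨ℓ, hℓ, hℓa, hℓm⟩ := Nat.Prime.not_coprime_iff_dvd.mp hnc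
    have hℓp : ℓ ≠ p := fun h ↦ hpa (h ▸ hℓa)
    have hℓp' : ¬ ℓ ∣ p := fun h ↦ hℓp ((Nat.prime_dvd_prime_iff_eq hℓ hpr).mp h)
    have hℓc : ℓ ∣ φ'.conductor :=
      dvd_conductor_mul_of_dvd χq hφprim hℓ hℓm hℓp' (dvd_mul_right p m) (dvd_mul_left m p)
    obtain ⟨v, hv, hvℓ⟩ := hSm ℓ hℓ hℓc hℓp
    exact hSa ⟨v, hv, by rw [natGenerator_eq_of_natCast_mem_asIdeal hℓ hvℓ]; exact hℓa⟩
  have hagreeD : ∀ a : ℕ, ¬ p ∣ a →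
      ψ' (a : ZMod (d * p)) = ψ'.primitiveCharacter (a : ZMod ψ'.conductor) := by
    intro a hpa
    by_cases had : a.Coprime d
    · exact apply_natCast_eq_primitiveCharacter_of_coprime ψ' (Nat.Coprime.mul_right had (hcopP a hpa))
    · obtain ⟨ℓ, hℓ, hℓa, hℓd⟩ := Nat.Prime.not_coprime_iff_dvd.mp had
      have hℓp : ℓ ≠ p := fun h ↦ hpa (h ▸ hℓa)
      have hℓp' : ¬ ℓ ∣ p := fun h ↦ hℓp ((Nat.prime_dvd_prime_iff_eq hℓ hpr).mp h)
      have hℓc : ℓ ∣ ψ'.conductor :=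
        dvd_conductor_mul_of_dvd' χq hψprim hℓ hℓd hℓp' (dvd_mul_left p d) (dvd_mul_right d p)
      exact apply_natCast_eq_primitiveCharacter_of_dvd ψ' hℓ hℓa (Dvd.dvd.mul_right hℓd p) hℓc
  have hgC' : IsCharacterLFunctionC p φ' S₀ gC :=
    (isCharacterLFunctionC_iff_of_apply_eq p S₀ φ' φ'.primitiveCharacter (Nat.pos_of_ne_zero (NeZero.ne _))
      (Nat.pos_of_ne_zero (NeZero.ne _)) hagreeC gC).mpr hgC
  have hgD' : IsCharacterLFunctionD p ψ' S₀ gD :=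
    (isCharacterLFunctionD_iff_of_apply_eq p S₀ ψ' ψ'.primitiveCharacter (Nat.pos_of_ne_zero (NeZero.ne _))
      (Nat.pos_of_ne_zero (NeZero.ne _)) hS₀nat hagreeD gD).mpr hgD
  -- normalise the unit away: `b₀ = u⁻¹ b`, `ι b₀ = ϖ · B`
  set b₀ : IwasawaAlgebra p := PowerSeries.C ((u⁻¹ : ℤ_[p]ˣ) : ℤ_[p]) * b with hb₀def
  have hb₀ : iwasawaToPowerSeries p b₀ = PowerSeries.C ((ϖ : ℚ) : ℚ_[p]) *
      padicLFunctionBranch f ((unitRoot V p : ℤ_[p]) : ℚ_[p]) (p / 2) := by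
    rw [hb₀def, map_mul, hb, ← mul_assoc]
    congr 1
    change PowerSeries.map _ (PowerSeries.C _) * _ = _
    rw [PowerSeries.map_C, ← map_mul]
    congr 1
    change (((u⁻¹ : ℤ_[p]ˣ) : ℤ_[p]) : ℚ_[p]) * _ = _
    rw [← mul_assoc, ← PadicInt.coe_mul, Units.inv_mul, PadicInt.coe_one, one_mul]
  -- T311χ
  haveI := hm
  haveI := hdne
  obtain ⟨hiff, hordeq⟩ := h311 V p W f S₀ Φ₁ m φ d ψ hp2 hp4 ⟨hgood, hord⟩ ⟨C, hC⟩ hΦ₁r hram₁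
    heven₁ hf hφprim hψprim hφ0 hψ0 hS₀ hSV ϖ hϖ b₀ hb₀ gC gD hgC' hgD'
  -- conclusion: unit content
  have hCD : HasUnitContent (gC * gD) := by
    rw [hasUnitContent_iff_map_toZMod_ne_zero, map_mul]
    exact mul_ne_zero ((hasUnitContent_iff_map_toZMod_ne_zero gC).mp hCunit)
      ((hasUnitContent_iff_map_toZMod_ne_zero gD).mp hDunit)
  have hu0 : IsUnit (PowerSeries.C ((u⁻¹ : ℤ_[p]ˣ) : ℤ_[p]) : IwasawaAlgebra p) :=
    (u⁻¹).isUnit.map PowerSeries.C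
  have hb₀X : b₀ * eulerFactorProduct W p S₀ =
      PowerSeries.C ((u⁻¹ : ℤ_[p]ˣ) : ℤ_[p]) * (b * eulerFactorProduct W p S₀) := mul_assoc _ _ _
  have hunit : HasUnitContent (b * eulerFactorProduct W p S₀) := by
    have h := hiff.mpr hCD
    rwa [hb₀X, hasUnitContent_unit_mul_iff hu0] at h
  refine ⟨hunit, ?_⟩
  -- conclusion: `ord_T` is additive
  have hord1 := hordeq hCD
  have hū : PadicInt.toZMod ((u⁻¹ : ℤ_[p]ˣ) : ℤ_[p]) ≠ 0 :=
    ((u⁻¹).isUnit.map (PadicInt.toZMod (p := p))).ne_zero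
  have hordC : ∀ g : PowerSeries (ZMod p),
      (PowerSeries.C (PadicInt.toZMod ((u⁻¹ : ℤ_[p]ˣ) : ℤ_[p])) * g).order = g.order := fun g ↦ by
    rw [PowerSeries.order_mul, ← PowerSeries.monomial_zero_eq_C_apply,
      PowerSeries.order_monomial_of_ne_zero 0 _ hū, Nat.cast_zero, zero_add]
  rw [hb₀X, map_mul, PowerSeries.map_C, hordC] at hord1
  have hCfin : (PowerSeries.map (PadicInt.toZMod (p := p)) gC).order ≠ ⊤ := fun h ↦
    (hasUnitContent_iff_map_toZMod_ne_zero gC).mp hCunit (PowerSeries.order_eq_top.mp h)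
  have hDfin : (PowerSeries.map (PadicInt.toZMod (p := p)) gD).order ≠ ⊤ := fun h ↦
    (hasUnitContent_iff_map_toZMod_ne_zero gD).mp hDunit (PowerSeries.order_eq_top.mp h)
  change p ^ _ =
    Nat.card (unramifiedOutside κ.kerSubgroup (lineSub Φ₀ hΦ).Sub p
        (↑S₀ : Set (HeightOneSpectrum (𝓞 ℚ)))) *
      Nat.card (unramifiedSelmer κ.kerSubgroup (lineSub Φ₀ hΦ).Quot p
        (↑S₀ : Set (HeightOneSpectrum (𝓞 ℚ))))
  rw [hord1, map_mul, PowerSeries.order_mul, ENat.toNat_add hCfin hDfin, pow_add, hCcard, hDcard]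

end Summit.BirchSwinnertonDyer.BirchSwinnertonDyer.Theorems.AdditiveBranchIMCGreenbergVatsalResidualBranchOfPrint

end
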